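/-
Copyright (c) 2026. All rights reserved.
Released under Apache 2.0 license as described in the file LICENSE.
Authors: abc-iut cell, seat abc-iut-L6-t6 (gen 5; junction row «J-Fmod», L6-lead §F v1.19g; part 2 of 2).
-/
import Literature.IUT.HodgeTheaters.GlobalFrobenioidsArithmeticPullback
import Literature.IUT.LogThetaLattice.GlobalFrobenioidModelsEffArithDivisors
import Literature.IUT.LogThetaLattice.GlobalFrobenioidsFmodPoint
import HarnessLib

/-!
# Junction «J-Fmod»: [IUTchI] Ex 5.1 (iii)'s `†ℱ^⊛_mod` AT THE ARITHMETIC MODEL ≌ [IUTchIII] Ex 3.6 /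
# Prop 3.7's `(†𝓕⊛_mod)_α` in [FrdI] Thm 5.2 model form — "identity on `F^×_mod`" (part 2 of 2)

S. Mochizuki, *Inter-universal Teichmüller Theory I*, Example 5.1 (iii) p. 126 ([IUTchI] Ex 5.1 (iii) p.126), and
*Inter-universal Teichmüller Theory III*, Example 3.6 (i)(ii) pp. 107–108 ([IUTchIII] Ex 3.6 (ii) p.108),
Proposition 3.7 (ii) p. 110: "`𝓕⊛_𝔪𝔬𝔡` … a natural Frobenioid structure … base category … with precisely one arrow
… a natural isomorphism of Frobenioids `𝓕⊛_mod ⥲ 𝓕⊛_𝔪𝔬𝔡` that induces the identity morphism `F^×_mod → F^×_mod`"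
[claim: Mochizuki2012, status: disputed]; [cite: MochizukiFrdI2008, Ex. 6.3 p.113] for the mathematics.

THE TWO SIDES.  L5 (abc-iut-L5-t1): `GlobalFrobenioid.Fmod` — the full subcategory of `†ℱ^⊛ ≃ ℱ^⊛(†𝒟^⊚)` over the
terminal objects of `†𝒟^⊛`; at the ARITHMETIC MODEL `GlobalDivisorData.arith F` (`GlobalFrobenioidsArithmeticModel.lean`:
abc-iut-L1's [FrdI] Ex 6.3 data `(arithDivisorFunctor, unitsFunctor, divNatTrans)` along the Galois correspondence
`ℬ(G_F)⁰ ⥤ FinSubextCat F F̄`) the number field of a terminal object is `F` itself, as the bottom subextension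
(`arith_field_terminal`).  L6 (abc-iut-L6-t6, -L6-t4, -w4-d005): `Prop37.FmodModel F` — the model Frobenioid over
the one-arrow base of (effective families `{D_v ∈ Γ_v^{≥0}}_v` at `Γ_v = ℤ, ℝ`; `F^×`; `f ↦ (β_v(f))_v`), equivalent
to `𝓕⊛_𝔪𝔬𝔡 = Prop37.Ffrak F` (`Prop37.isoFrakMod`).  The L5↔L6 identification was name-level only (MERGE-MAP §1 row
GlobalFrobenioidModels; abc-iut-L6-t6 g4 04:09:59Z "one honest residual").  This file closes it:

* (input, `GlobalFrobenioidModelsEffArithDivisors.lean`) the L6↔L1 dictionary at `F`: Ex 3.6's EFFECTIVE families ARE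
  [FrdI] Ex 6.3's effective arithmetic divisors of `F` — `Prop37.effDivHom` (bijective, `gpMap_effDivHom_toGp`);
  (input, `GlobalFrobenioidsFmodPoint.lean` = part 1) `FmodJunction.fmodEquiv`: `†ℱ^⊛_mod ≌` the model Frobenioid
  of any one-point datum mapping bijectively to `Δ` at a terminal object.
* §4 (any "corresponding subfield" functor `S : ℬ(G)⁰ ⥤ FinSubextCat F F̄`, object `T`): the morphism of model data
  `Prop37.pointDataHom F S T` over `∗ ↦ T` from `(Φ, F^×, β)` to `(Φ ∘ S, 𝔹 ∘ S, div ∘ S)` (`subfieldData`, the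
  common shape of `arith` and `arithAlong`, ON THE NOSE) — components = pull-back of effective arithmetic divisors
  and of units along `algebraMap F ↥(S T).L` (L1's `EffArithDivisor.pullback`; compatibility =
  `ArithDivisor.pullback_principalArithDivisor` + `frakObjEquiv_betaDiv` + `EffArithDivisor.gpHom_map`); both
  bijective when `(S T).L = ⊥`; whence `fmodEquivOfSubfields` (part 1's `FmodJunction.fmodEquiv`).
* §5 **THE JUNCTION** at `GlobalDivisorData.arith F`: `Prop37.fmodJunctionAt` (any terminal `T`) and
  **`Prop37.fmodJunction (GF) : GF.Fmod ≌ Prop37.FmodModel F`** for EVERY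
  `GF : GlobalFrobenioid (GlobalDivisorData.arith F) Dcirc toBase0`; `Prop37.fmodJunctionFrak : GF.Fmod ≌ Ffrak F`.
  "Induces the identity on `F^×_mod`": the EXPLICIT inverse functor `FmodModel F ⥤ GF.Fmod` is `Ψ ⋙ equiv⁻¹`
  (`fmodJunctionAt_inverse`, `fmodJunctionAtInverseIso`), and `Ψ` sends `(n, 𝟙, D, f)` to a morphism with the same
  Frobenius degree and unit component `algebraMap F ↥⊥ (f)` — the tautological `F = ↥⊥`
  (`unit_arithPointDataHom_functor_map`).
* §6 the same over a GENERAL `†𝒟^⊛ = ℬ(G)⁰` with `ρ : π₁(†𝒟^⊛) ↠ G_F` (abc-iut-L5's `GlobalDivisorData.arithAlong F ρ hρ`,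
  = `subfieldData` of `subfieldFunctor ρ` on the nose): `subfieldFunctor_field_terminal` (the field of a terminal
  object is `⊥`: `G_F ×^G {∗}` is fixed by all of `G_F`), **`fmodJunctionAlongAt` / `fmodJunctionAlong` /
  `fmodJunctionAlongFrak`**.

HONEST SCOPE.  (1) Both junctions are at abc-iut-L5's MODELS of the divisor data ([FrdI] Ex 6.3 via the Galois
correspondence); an abstract `Δ : GlobalDivisorData G` is covered by part 1's `fmodEquiv` given any bijective
one-point datum.  (2) "Stack-theoretic" caveat as in
`GlobalFrobenioidsArithmeticModel.lean` ([IUTchI] Rmk 3.1.5; L1 types [FrdI] Ex 6.3 AS STATED).  (3) The functor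
`GF.Fmod ⥤ FmodModel F` is the (choice-dependent) inverse equivalence of the explicit one; formulas are stated for
the latter.  Nothing here asserts a disputed claim or takes a side on [IUTchIII] Cor. 3.12 (typed ≠ discharged;
instantiated ≠ endorsed).
-/

noncomputable section

namespace Literature.IUT.LogThetaLattice

open CategoryTheory Opposite Function CategoryTheory.Limits
open Literature.AlgebraicGeometry.Frobenioids Literature.AlgebraicGeometry.Frobenioids.QuasiTemperoid
open Literature.IUT.HodgeTheaters

namespace Prop37

open GlobalFrobenioidModels

/-! ## §4 The one-point datum of `F` mapped into [FrdI] Ex 6.3's data along `F → ↥(S T).L` -/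

section Transport

variable {M : Type} [Field M] [NumberField M] {L : Type} [Field L] [NumberField L]

/-- Pull-back of effective arithmetic divisors along a BIJECTIVE ring homomorphism is bijective (functoriality,
L1's `EffArithDivisor.pullback_comp` / `pullback_id`). [cite: MochizukiFrdI2008, Ex. 6.3 p.113] -/
theorem effArithDivisor_pullback_bijective (σ : M →+* L) (hσ : Bijective σ) :
    Bijective (EffArithDivisor.pullback σ) := by
  obtain ⟨e, rfl⟩ : ∃ e : M ≃+* L, e.toRingHom = σ := ⟨RingEquiv.ofBijective σ hσ, RingHom.ext fun _ => rfl⟩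
  refine bijective_iff_has_inverse.mpr ⟨EffArithDivisor.pullback e.symm.toRingHom, fun D => ?_, fun D => ?_⟩
  · rw [← EffArithDivisor.pullback_comp, RingEquiv.symm_toRingHom_comp_toRingHom, EffArithDivisor.pullback_id]
  · rw [← EffArithDivisor.pullback_comp, RingEquiv.toRingHom_comp_symm_toRingHom, EffArithDivisor.pullback_id]

omit [NumberField M] [NumberField L] in
/-- The map of units along a BIJECTIVE ring homomorphism is bijective. [cite: MochizukiFrdI2008, Ex. 6.3 p.113] -/
theorem units_map_bijective (σ : M →+* L) (hσ : Bijective σ) : Bijective (Units.map (σ : M →* L)) := by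
  obtain ⟨e, rfl⟩ : ∃ e : M ≃+* L, e.toRingHom = σ := ⟨RingEquiv.ofBijective σ hσ, RingHom.ext fun _ => rfl⟩
  have h : ⇑(Units.map (e.toRingHom : M →* L)) = ⇑(Units.mapEquiv e.toMulEquiv) :=
    funext fun u => Units.ext rfl
  rw [h]
  exact (Units.mapEquiv e.toMulEquiv).bijective

/-- For an intermediate field EQUAL to `⊥`, `algebraMap F L` is bijective (the tautological `F = ↥⊥`).
[cite: MochizukiFrdI2008, Ex. 6.3 p.113] -/
theorem bijective_algebraMap_of_eq_bot (F : Type) [Field F] {K : Type} [Field K] [Algebra F K]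
    {L : IntermediateField F K} (hL : L = ⊥) : Bijective (algebraMap F L) := by
  subst hL
  have h : ⇑(algebraMap F (⊥ : IntermediateField F K)) = ⇑(IntermediateField.botEquiv F K).symm :=
    funext fun x => (IntermediateField.botEquiv_symm x).symm
  rw [h]
  exact (IntermediateField.botEquiv F K).symm.bijective

variable (F : Type) [Field F] [NumberField F]
variable {G : ProfiniteGrp.{0}} (S : BaseCat G ⥤ FinSubextCat F (Fbar F)) (T : BaseCat G)

/-- [IUTchI] Ex 5.1 (ii)'s divisor data `(Φ ∘ S, 𝔹 ∘ S, div ∘ S)` on `†𝒟^⊛ = ℬ(G)⁰` along a "corresponding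
subfield" functor `S : ℬ(G)⁰ ⥤ FinSubextCat F F̄` — the common shape of `GlobalDivisorData.arith F`
(`S` = the Galois correspondence) and `GlobalDivisorData.arithAlong F ρ hρ` (`S = subfieldFunctor ρ`).
([IUTchI] Ex 5.1 (ii) p.125) [claim: Mochizuki2012, status: disputed] -/
abbrev subfieldData : GlobalDivisorData G :=
  ⟨S.op ⋙ arithDivisorFunctor F (Fbar F), S.op ⋙ unitsFunctor F (Fbar F),
    Functor.whiskerLeft S.op (divNatTrans F (Fbar F))⟩

/-- `GlobalDivisorData.arith F` IS `subfieldData` along the Galois correspondence (on the nose).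
([IUTchI] Ex 5.1 (ii) p.125) [claim: Mochizuki2012, status: disputed] -/
theorem arith_eq_subfieldData : GlobalDivisorData.arith F = subfieldData F (galoisSubextOfFinite F) := rfl

/-- `GlobalDivisorData.arithAlong F ρ hρ` IS `subfieldData` along `subfieldFunctor ρ` (on the nose).
([IUTchI] Ex 5.1 (ii) p.125) [claim: Mochizuki2012, status: disputed] -/
theorem arithAlong_eq_subfieldData (ρ : G →ₜ* GalFbar F) (hρ : Surjective ρ) :
    GlobalDivisorData.arithAlong F ρ hρ = subfieldData F (subfieldFunctor F ρ hρ) := rfl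

/-- The number field "corresponding to" `T` along `S` (as a type). ([IUTchI] Ex 5.1 (ii) p.125)
[claim: Mochizuki2012, status: disputed] -/
abbrev fieldAt : Type := ↥(S.obj T).L

/-- `η` at the unique object: an effective family of `F` ↦ its effective arithmetic divisor, pulled back to the
field of `T` along `algebraMap F ↥(S T).L`. ([IUTchI] Ex 5.1 (iii) p.126) [claim: Mochizuki2012, status: disputed] -/
def pointEtaHom : EffDiv (Places F) (Gamma F) (nonneg F) →* Multiplicative (EffArithDivisor (fieldAt F S T)) :=
  (AddMonoidHom.toMultiplicative (EffArithDivisor.pullback (algebraMap F (fieldAt F S T)))).comp (effDivHom F)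

/-- `β` at the unique object: `F^× → (↥(S T).L)^×` along `algebraMap`. ([IUTchI] Ex 5.1 (iii) p.126)
[claim: Mochizuki2012, status: disputed] -/
def pointBetaHom : Fˣ →* (fieldAt F S T)ˣ := Units.map (algebraMap F (fieldAt F S T) : F →* fieldAt F S T)

/-- `η : Φ → (Φ ∘ S)|_{∗ ↦ T}` as a homomorphism of monoids on the one-arrow base.
([IUTchI] Ex 5.1 (iii) p.126) [claim: Mochizuki2012, status: disputed] -/
def pointEta : Φmod (Places F) (Gamma F) (nonneg F) ⟶ (FmodJunction.pointFunctor.{0} T).op ⋙ (subfieldData F S).Φ where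
  app _ := CommMonCat.ofHom (pointEtaHom F S T)
  naturality X Y f := by
    obtain ⟨⟨⟨⟩⟩⟩ := X
    obtain ⟨⟨⟨⟩⟩⟩ := Y
    have hf : f = 𝟙 _ := Quiver.Hom.unop_inj (Subsingleton.elim _ _)
    subst hf
    rw [CategoryTheory.Functor.map_id, Category.id_comp, CategoryTheory.Functor.map_id, Category.comp_id]

/-- `β : 𝔹 → (𝔹 ∘ S)|_{∗ ↦ T}` as a homomorphism of monoids on the one-arrow base.
([IUTchI] Ex 5.1 (iii) p.126) [claim: Mochizuki2012, status: disputed] -/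
def pointBeta : Bmod F ⟶ (FmodJunction.pointFunctor.{0} T).op ⋙ (subfieldData F S).B where
  app _ := CommMonCat.ofHom (pointBetaHom F S T)
  naturality X Y f := by
    obtain ⟨⟨⟨⟩⟩⟩ := X
    obtain ⟨⟨⟨⟩⟩⟩ := Y
    have hf : f = 𝟙 _ := Quiver.Hom.unop_inj (Subsingleton.elim _ _)
    subst hf
    rw [CategoryTheory.Functor.map_id, Category.id_comp, CategoryTheory.Functor.map_id, Category.comp_id]

/-- Unfolding, left: `η^gp (Div_𝔹 f) = (pointEtaHom)^gp (toGp (β_v(f))_v)`.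
([IUTchI] Ex 5.1 (iii) p.126) [claim: Mochizuki2012, status: disputed] -/
theorem gpApp_pointEta_divB (u : Fˣ) :
    gpApp (pointEta F S T) (op pt)
        (divB (Φmod (Places F) (Gamma F) (nonneg F)) (Bmod F) (divBmod (modelHyps F)) (op pt) u) =
      MonGp.map (pointEtaHom F S T) (toGp (modelHyps F) (betaDiv (modelHyps F) u)) := rfl

/-- Unfolding, right: the divisor map of the restricted data at `∗` is L1's `div` at the field of `T`,
`gpEquiv⁻¹ ∘ (f ↦ div f)`. ([IUTchI] Ex 5.1 (iii) p.126) [claim: Mochizuki2012, status: disputed] -/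
theorem divB_restrict_pointBeta (u : Fˣ) :
    divB ((FmodJunction.pointFunctor.{0} T).op ⋙ (subfieldData F S).Φ)
        ((FmodJunction.pointFunctor.{0} T).op ⋙ (subfieldData F S).B)
        (ModelFrobenioid.divBRestrict (FmodJunction.pointFunctor.{0} T) _ _ (subfieldData F S).div) (op pt)
        (((pointBeta F S T).app (op pt)).hom u) =
      (EffArithDivisor.gpEquiv (fieldAt F S T)).symm
        (principalArithDivisorHom (fieldAt F S T)
          (Units.map (algebraMap F (fieldAt F S T) : F →* fieldAt F S T) u)) := rfl

/-- **The compatibility `div(σ f) = η^gp(Div_𝔹 f)`** at the unique object, `σ = algebraMap F ↥(S T).L`: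
`frakObjEquiv (β_v(f))_v = div(f)` (abc-iut-w4-d005), `σ^* div(f) = div(σ f)` (abc-iut-L1) and the naturality of
`Φ^gp ≅ ArithDivisor` (`EffArithDivisor.gpHom_map`). ([IUTchI] Ex 5.1 (iii) p.126) [claim: Mochizuki2012, status: disputed] -/
theorem gpMap_pointEtaHom_divBHom (u : Fˣ) :
    MonGp.map (pointEtaHom F S T) (toGp (modelHyps F) (betaDiv (modelHyps F) u)) =
      (EffArithDivisor.gpEquiv (fieldAt F S T)).symm
        (principalArithDivisorHom (fieldAt F S T)
          (Units.map (algebraMap F (fieldAt F S T) : F →* fieldAt F S T) u)) := by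
  rw [pointEtaHom, MonGp.map_comp, MonoidHom.comp_apply,
    show betaDiv (modelHyps F) u = Multiplicative.ofAdd (Multiplicative.toAdd (betaDiv (modelHyps F) u))
      from rfl,
    gpMap_effDivHom_toGp, frakObjEquiv_betaDiv]
  apply (EffArithDivisor.gpEquiv (fieldAt F S T)).injective
  rw [MulEquiv.apply_symm_apply, EffArithDivisor.gpEquiv_apply, EffArithDivisor.gpHom_map,
    ← EffArithDivisor.gpEquiv_apply, MulEquiv.apply_symm_apply]
  change Multiplicative.ofAdd (ArithDivisor.pullback (algebraMap F (fieldAt F S T)) (principalArithDivisor F u)) =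
    Multiplicative.ofAdd (principalArithDivisor (fieldAt F S T)
      (Units.map (algebraMap F (fieldAt F S T) : F →* fieldAt F S T) u))
  rw [ArithDivisor.pullback_principalArithDivisor]

/-- **The morphism of model data over `∗ ↦ T`** from the one-point datum `(Φ, F^×, β)` of [IUTchIII] Ex 3.6 (at
`Γ_v = ℤ, ℝ`) to `(Φ ∘ S, 𝔹 ∘ S, div ∘ S)`: `η = pointEta`, `β = pointBeta`, compatibility
`gpMap_pointEtaHom_divBHom`. ([IUTchI] Ex 5.1 (iii) p.126) [claim: Mochizuki2012, status: disputed] -/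
def pointDataHom : ModelFrobenioid.DataHomOver (FmodJunction.pointFunctor.{0} T)
    (divBmod (modelHyps F)) (subfieldData F S).div where
  η := pointEta F S T
  β := pointBeta F S T
  comm A u := by
    obtain ⟨⟨⟨⟩⟩⟩ := A
    exact (gpApp_pointEta_divB F S T u).trans
      ((gpMap_pointEtaHom_divBHom F S T u).trans (divB_restrict_pointBeta F S T u).symm)

/-- When the field of `T` is the bottom subextension, `η` is bijective at the unique object.
([IUTchI] Ex 5.1 (iii) p.126) [claim: Mochizuki2012, status: disputed] -/
theorem pointDataHom_eta_bijective (hL : (S.obj T).L = ⊥) :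
    Bijective ((pointDataHom F S T).η.app (op pt)).hom := by
  change Bijective (pointEtaHom F S T)
  exact (effArithDivisor_pullback_bijective _ (bijective_algebraMap_of_eq_bot F hL)).comp
    (effDivHom_bijective F)

/-- When the field of `T` is the bottom subextension, `β` is bijective at the unique object.
([IUTchI] Ex 5.1 (iii) p.126) [claim: Mochizuki2012, status: disputed] -/
theorem pointDataHom_beta_bijective (hL : (S.obj T).L = ⊥) :
    Bijective ((pointDataHom F S T).β.app (op pt)).hom := by
  change Bijective (pointBetaHom F S T)
  exact units_map_bijective _ (bijective_algebraMap_of_eq_bot F hL)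

/-- "induces the identity on `F^×_mod`": the induced functor of model Frobenioids sends a morphism with unit
component `f ∈ F^×` to one with unit component `algebraMap F ↥(S T).L (f)`.
([IUTchIII] Ex 3.6 (ii) p.108) [claim: Mochizuki2012, status: disputed] -/
theorem unit_pointDataHom_functor_map {X Y : FmodModel F} (φ : X ⟶ Y) :
    ModelFrobenioid.unit ((pointDataHom F S T).functor.map φ) =
      Units.map (algebraMap F (fieldAt F S T) : F →* fieldAt F S T) (ModelFrobenioid.unit φ : Fˣ) :=
  rfl

/-- **`†ℱ^⊛_mod ≌ (†𝓕⊛_mod)_α` (model form) along any subfield functor `S`, at a terminal `T` whose field is `⊥`.**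
([IUTchI] Ex 5.1 (iii) p.126) [claim: Mochizuki2012, status: disputed] -/
def fmodEquivOfSubfields {Dcirc : Type 1} [Category.{0} Dcirc] {toBase0 : Dcirc ⥤ BaseCat G}
    (GF : GlobalFrobenioid (subfieldData F S) Dcirc toBase0) {T : BaseCat G} (hT : IsTerminal T)
    (hL : (S.obj T).L = ⊥) : GF.Fmod ≌ FmodModel F :=
  FmodJunction.fmodEquiv GF (pointDataHom F S T) hT (pointDataHom_eta_bijective F S T hL)
    (pointDataHom_beta_bijective F S T hL)

end Transport

/-! ## §5 The junction at the arithmetic model `GlobalDivisorData.arith F` -/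

section Junction

variable (F : Type) [Field F] [NumberField F] {Dcirc : Type 1} [Category.{0} Dcirc]
  {toBase0 : Dcirc ⥤ BaseCat (absGalGrp F)}
  (GF : GlobalFrobenioid (GlobalDivisorData.arith F) Dcirc toBase0)

/-- The morphism of model data over `∗ ↦ T` into the ARITHMETIC MODEL `GlobalDivisorData.arith F`.
([IUTchI] Ex 5.1 (iii) p.126) [claim: Mochizuki2012, status: disputed] -/
abbrev arithPointDataHom (T : BaseCat (absGalGrp F)) :
    ModelFrobenioid.DataHomOver (FmodJunction.pointFunctor.{0} T) (divBmod (modelHyps F))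
      (GlobalDivisorData.arith F).div :=
  pointDataHom F (G := absGalGrp F) (galoisSubextOfFinite F) T

/-- **JUNCTION «J-Fmod» at a chosen terminal object `T` ("`C_{F_mod}`") of `†𝒟^⊛ = ℬ(G_F)⁰`**: abc-iut-L5-t1's
literal `†ℱ^⊛_mod = GF.Fmod` of ANY global Frobenioid `GF` over the arithmetic model is equivalent to
`(†𝓕⊛_mod)_α` in [FrdI] Thm 5.2 model form (`Prop37.FmodModel F`) — the number field of `T` being `F` itself
(`arith_field_terminal`). ([IUTchI] Ex 5.1 (iii) p.126) [claim: Mochizuki2012, status: disputed] -/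
def fmodJunctionAt {T : BaseCat (absGalGrp F)} (hT : IsTerminal T) : GF.Fmod ≌ FmodModel F :=
  fmodEquivOfSubfields F (G := absGalGrp F) (galoisSubextOfFinite F) GF hT (arith_field_terminal F hT)

/-- The inverse functor of the junction is EXPLICIT: `Ψ ⋙ equiv⁻¹` lifted to `†ℱ^⊛_mod`, `Ψ` the functor induced by
`arithPointDataHom`. ([IUTchI] Ex 5.1 (iii) p.126) [claim: Mochizuki2012, status: disputed] -/
theorem fmodJunctionAt_inverse {T : BaseCat (absGalGrp F)} (hT : IsTerminal T) :
    (fmodJunctionAt F GF hT).inverse = FmodJunction.lift GF (arithPointDataHom F T) hT := rfl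

/-- … on objects: `X ↦ equiv⁻¹ (Ψ X)`. ([IUTchI] Ex 5.1 (iii) p.126) [claim: Mochizuki2012, status: disputed] -/
theorem fmodJunctionAt_inverse_obj {T : BaseCat (absGalGrp F)} (hT : IsTerminal T) (X : FmodModel F) :
    ((fmodJunctionAt F GF hT).inverse.obj X).obj = GF.equiv.inverse.obj ((arithPointDataHom F T).functor.obj X) :=
  rfl

/-- The inverse functor of the junction followed by `†ℱ^⊛_mod ↪ †ℱ^⊛ ⥲ ℱ^⊛(†𝒟^⊚)` is `Ψ` (up to the counit of
`equiv`). ([IUTchI] Ex 5.1 (iii) p.126) [claim: Mochizuki2012, status: disputed] -/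
def fmodJunctionAtInverseIso {T : BaseCat (absGalGrp F)} (hT : IsTerminal T) :
    ((fmodJunctionAt F GF hT).inverse ⋙ GF.fmodIncl) ⋙ GF.equiv.functor ≅ (arithPointDataHom F T).functor :=
  Functor.isoWhiskerLeft (arithPointDataHom F T).functor GF.equiv.counitIso

/-- **"induces the identity morphism `F^×_mod → F^×_mod`"** ([IUTchIII] Ex 3.6 (ii) p. 108 l. 15–17; Prop 3.7 (ii)
"tautological isomorphisms on the associated rational function monoids"): through the junction a morphism
`(n, 𝟙, D, f)` of `(†𝓕⊛_mod)_α` goes to a morphism of `ℱ^⊛(†𝒟^⊚)` whose rational-function component is `f`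
viewed in the number field `↥⊥ = F` of `T` (`algebraMap F ↥(E T).L`), with the same Frobenius degree.
([IUTchIII] Ex 3.6 (ii) p.108) [claim: Mochizuki2012, status: disputed] -/
theorem unit_arithPointDataHom_functor_map (T : BaseCat (absGalGrp F)) {X Y : FmodModel F} (φ : X ⟶ Y) :
    ModelFrobenioid.unit ((arithPointDataHom F T).functor.map φ) =
        pointBetaHom F (G := absGalGrp F) (galoisSubextOfFinite F) T (ModelFrobenioid.unit φ : Fˣ) ∧
      ModelFrobenioid.degFr ((arithPointDataHom F T).functor.map φ) = ModelFrobenioid.degFr φ :=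
  ⟨unit_pointDataHom_functor_map F (G := absGalGrp F) (galoisSubextOfFinite F) T φ, rfl⟩

/-- **JUNCTION «J-Fmod»** (choice of the terminal object made once and for all: `†𝒟^⊛` HAS a terminal object,
abc-iut-w4-d050's `exists_isTerminal_baseCat`): **`GF.Fmod ≌ Prop37.FmodModel F`**.
([IUTchI] Ex 5.1 (iii) p.126) [claim: Mochizuki2012, status: disputed] -/
def fmodJunction : GF.Fmod ≌ FmodModel F :=
  fmodJunctionAt F GF (exists_isTerminal_baseCat (absGalGrp F)).choose_spec.some

/-- **`†ℱ^⊛_mod ≌ 𝓕⊛_𝔪𝔬𝔡`**: the junction composed with [IUTchIII] Prop 3.7 (ii)'s `(†𝓕⊛_mod)_α ⥲ (†𝓕⊛_𝔪𝔬𝔡)_α`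
(w4-d005's `Prop37.isoFrakMod`, L6-t6's `toModel`). ([IUTchIII] Ex 3.6 (ii) p.108) [claim: Mochizuki2012, status: disputed] -/
def fmodJunctionFrak : GF.Fmod ≌ Ffrak F := (fmodJunction F GF).trans (isoFrakMod F).symm

end Junction

/-! ## §6 The junction over a general `†𝒟^⊛ = ℬ(G)⁰`, `π₁(†𝒟^⊛) ↠ G_F` (`GlobalDivisorData.arithAlong`) -/

section Along

open Literature.AnabelianGeometry.SemiGraphs

variable (F : Type) [Field F] [NumberField F] {G : ProfiniteGrp.{0}} (ρ : G →ₜ* GalFbar F) (hρ : Surjective ρ)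

/-- Along a continuous SURJECTION `ρ : π₁(†𝒟^⊛) ↠ G_F`, "the corresponding subfield" of a TERMINAL object
("`C_{F_mod}`", a one-point `G`-set — abc-iut-L5's `subsingleton_of_isTerminal`) is the bottom subextension
`F ⊆ F̄`: the induced `G_F`-set `G_F ×^G {∗}` ([FrdII] Ex 1.3 (ii), abc-iut-L1's `inductionFunctorConnected`) is
fixed pointwise by every `σ ∈ G_F` (`σ·[(q, ∗)] = [(σ q, ∗)] = [(q, ∗)]` with `ρ(g) = q⁻¹ σ q`), so the stabiliser
of its base point is all of `G_F`, whose fixed field is `F` (Krull). ([IUTchI] Ex 5.1 (iii) p.126)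
[claim: Mochizuki2012, status: disputed] -/
theorem subfieldFunctor_field_terminal {T : BaseCat G} (hT : IsTerminal T) :
    ((subfieldFunctor F ρ hρ).obj T).L = ⊥ := by
  haveI : IsGalois F (Fbar F) := isGalois_fbar F
  haveI : Subsingleton ((BCat.connectedToBTemp G).obj T).obj.obj.V := subsingleton_of_isTerminal hT
  let Z : ConnectedPart (BTemp (GalFbar F)) :=
    (inductionFunctorConnected ρ.toMonoidHom (isOpenMap_of_surjective F ρ hρ) (countable_quotient_of_isOpen F)).obj
      ((BCat.connectedToBTemp G).obj T)
  have hfix : ∀ (σ : GalFbar F) (c : Z.obj.obj.V), Z.obj.obj.ρ σ c = c := by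
    intro σ c
    refine inducedSet_ind (p := fun c => Z.obj.obj.ρ σ c = c) (fun q x => ?_) c
    obtain ⟨g, hg⟩ := hρ (q⁻¹ * σ * q)
    change (inducedObj ρ.toMonoidHom (isOpenMap_of_surjective F ρ hρ) (countable_quotient_of_isOpen F)
      ((BCat.connectedToBTemp G).obj T).obj).obj.ρ σ (inducedMk q x) = inducedMk q x
    rw [inducedObj_ρ_mk]
    refine inducedMk_eq_iff.2 ⟨g, ?_, Subsingleton.elim _ _⟩
    rw [show ρ.toMonoidHom g = q⁻¹ * σ * q from hg]
    group
  have htop : stabilizerSubgroup Z.obj (basePt Z) = ⊤ :=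
    eq_top_iff.mpr fun σ _ => mem_stabilizerSubgroup_iff.mpr (hfix σ _)
  change fixFld F Z = ⊥
  rw [fixFld, htop, ← IntermediateField.fixingSubgroup_bot, InfiniteGalois.fixedField_fixingSubgroup]

variable {Dcirc : Type 1} [Category.{0} Dcirc] {toBase0 : Dcirc ⥤ BaseCat G}
  (GF : GlobalFrobenioid (GlobalDivisorData.arithAlong F ρ hρ) Dcirc toBase0)

/-- **JUNCTION «J-Fmod» over a general `†𝒟^⊛`** (`π₁(†𝒟^⊛) = G ↠ G_F`, abc-iut-L5's pulled-back model
`GlobalDivisorData.arithAlong F ρ hρ`), at a terminal object `T`: `GF.Fmod ≌ Prop37.FmodModel F`.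
([IUTchI] Ex 5.1 (iii) p.126) [claim: Mochizuki2012, status: disputed] -/
def fmodJunctionAlongAt {T : BaseCat G} (hT : IsTerminal T) : GF.Fmod ≌ FmodModel F :=
  fmodEquivOfSubfields F (G := G) (subfieldFunctor F ρ hρ) GF hT (subfieldFunctor_field_terminal F ρ hρ hT)

/-- The inverse functor of the junction over `†𝒟^⊛` is the explicit `Ψ ⋙ equiv⁻¹`, `Ψ` induced by
`pointDataHom F (subfieldFunctor F ρ hρ) T` (unit component `f ↦ algebraMap F ↥⊥ (f)` — "identity on `F^×_mod`",
`unit_pointDataHom_functor_map`). ([IUTchI] Ex 5.1 (iii) p.126) [claim: Mochizuki2012, status: disputed] -/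
theorem fmodJunctionAlongAt_inverse {T : BaseCat G} (hT : IsTerminal T) :
    (fmodJunctionAlongAt F ρ hρ GF hT).inverse =
      FmodJunction.lift GF (pointDataHom F (G := G) (subfieldFunctor F ρ hρ) T) hT := rfl

/-- **JUNCTION «J-Fmod» over a general `†𝒟^⊛`**, terminal object chosen once and for all
(`exists_isTerminal_baseCat`): `GF.Fmod ≌ Prop37.FmodModel F`. ([IUTchI] Ex 5.1 (iii) p.126)
[claim: Mochizuki2012, status: disputed] -/
def fmodJunctionAlong : GF.Fmod ≌ FmodModel F :=
  fmodJunctionAlongAt F ρ hρ GF (exists_isTerminal_baseCat G).choose_spec.some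

/-- … and `GF.Fmod ≌ 𝓕⊛_𝔪𝔬𝔡` over a general `†𝒟^⊛`. ([IUTchIII] Ex 3.6 (ii) p.108) [claim: Mochizuki2012, status: disputed] -/
def fmodJunctionAlongFrak : GF.Fmod ≌ Ffrak F := (fmodJunctionAlong F ρ hρ GF).trans (isoFrakMod F).symm

end Along

end Prop37

end Literature.IUT.LogThetaLattice

end
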